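import Mathlib
import Summits.Ventures.PercRepro.TriangleCapCherryMantel

/-!
# PercRepro — the bowtie at `(k, m) = (5, 6)`: the `K₄⁻`-free cherry maximum exceeds the complete-bipartite
value (p3, gen 29)

The lane's closing statement (P3-TRIANGLE-CAP.md §10x(e)) brackets the `K₄⁻`-free cherry maximum at
`m = a(k − a)` edges between the complete-bipartite value `m(k−2)/2` (attained by `K_{a,k−a}`, `mantel_eq_bip`)
and the envelope `m(k−1)/2` (`cherries_le_of_k4mFree`).  The engine's second implementation of the `k ≤ 9`
envelope table (INBOX 12184) flagged the one row where the lower end is STRICT: at `(5, 6)` the maximum `10` is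
the value of the BOWTIE (the windmill `W₂`, two triangles sharing a vertex), above the `9` of `K_{2,3}`.  This
module is that row in the kernel:

* `bowtie : SimpleGraph (Fin 5)` — the triangles `{0, 1, 2}` and `{0, 3, 4}`; `bowtie_adj`;
* `k4mFree_bowtie` — it is `K₄⁻`-free (every `4`-set carries `≤ 8` ordered adjacent pairs; decided);
* `cherries_bowtie = 10` (`C(4,2) + 4·C(2,2)`), `sum_deg_bowtie = 12`, `card_edges_bowtie = 6` (handshake);
* `cherries_bip_five_two = 9`, `card_edges_bip_five_two = 6` — the complete bipartite graph `K_{2,3}` on the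
  same `(k, m)`;
* **`bowtie_beats_bip`** — `K₄⁻`-free, the same number of edges, and `cherries (K_{2,3}) < cherries bowtie`;
* **`exists_k4mFree_gt_bip_value`** — a `K₄⁻`-free graph on `Fin 5` with `6` edges and `6·(5−2)/2 < cherries`.

The complete-bipartite rows of the table with `max = m(k−2)/2` are therefore `10` of the `11` (the other ten
are `(6,8) … (9,20)`, engine-twinned); no claim is made about the maximum at any other `(k, m)`.  Axioms: standard.
-/

namespace PercRepro

namespace TriangleCap

namespace C047

open Finset

/-- The bowtie `W₂` on `Fin 5`: the triangles `{0, 1, 2}` and `{0, 3, 4}` (centre `0`; the leaf pairs are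
`{1, 2}` — the pairs summing to `3` inside `{1, 2}` — and `{3, 4}` — the pair summing to `7`). -/
def bowtie : SimpleGraph (Fin 5) where
  Adj i j := i ≠ j ∧ (i.val = 0 ∨ j.val = 0 ∨ (i.val + j.val = 3 ∧ i.val ≤ 2 ∧ j.val ≤ 2) ∨ i.val + j.val = 7)
  symm := ⟨by decide⟩
  loopless := ⟨by decide⟩

/-- Adjacency in the bowtie is decidable. -/
instance decidableRelBowtie : DecidableRel bowtie.Adj :=
  fun i j => inferInstanceAs (Decidable (i ≠ j ∧
    (i.val = 0 ∨ j.val = 0 ∨ (i.val + j.val = 3 ∧ i.val ≤ 2 ∧ j.val ≤ 2) ∨ i.val + j.val = 7)))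

/-- `bowtie.Adj i j` unfolded. -/
theorem bowtie_adj (i j : Fin 5) : bowtie.Adj i j ↔
    i ≠ j ∧ (i.val = 0 ∨ j.val = 0 ∨ (i.val + j.val = 3 ∧ i.val ≤ 2 ∧ j.val ≤ 2) ∨ i.val + j.val = 7) :=
  Iff.rfl

/-- The bowtie is `K₄⁻`-free: every `4`-set carries at most `8` ordered adjacent pairs. -/
theorem k4mFree_bowtie : K4mFree bowtie := by
  unfold K4mFree
  decide

/-- `Σ_v C(d(v), 2) = C(4, 2) + 4·C(2, 2) = 10` on the bowtie. -/
theorem cherries_bowtie : cherries bowtie = 10 := by decide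

/-- `Σ_v d(v) = 4 + 2 + 2 + 2 + 2 = 12` on the bowtie. -/
theorem sum_deg_bowtie : ∑ v, deg bowtie v = 12 := by decide

/-- The bowtie has `6` edges (handshake). -/
theorem card_edges_bowtie : bowtie.edgeFinset.card = 6 := by
  have h := sum_deg_eq bowtie
  rw [sum_deg_bowtie] at h
  omega

/-- `Σ_v C(d(v), 2) = 2·C(3, 2) + 3·C(2, 2) = 9` on `K_{2,3}`. -/
theorem cherries_bip_five_two : cherries (bip 5 2) = 9 := by
  rw [cherries_bip 5 2 (by norm_num)]
  rfl

/-- `K_{2,3}` has `6` edges. -/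
theorem card_edges_bip_five_two : (bip 5 2).edgeFinset.card = 6 := by
  rw [card_edges_bip 5 2 (by norm_num)]

/-- **THE `(5, 6)` ROW:** the bowtie is `K₄⁻`-free, has as many edges as `K_{2,3}`, and strictly more cherries. -/
theorem bowtie_beats_bip :
    K4mFree bowtie ∧ bowtie.edgeFinset.card = (bip 5 2).edgeFinset.card ∧
      cherries (bip 5 2) < cherries bowtie := by
  refine ⟨k4mFree_bowtie, ?_, ?_⟩
  · rw [card_edges_bowtie, card_edges_bip_five_two]
  · rw [cherries_bip_five_two, cherries_bowtie]
    norm_num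

/-- **THE LOWER END IS STRICT AT `(5, 6)`:** a `K₄⁻`-free graph on `Fin 5` with `6` edges and
`6·(5−2)/2 = 9 < Σ_v C(d(v), 2)`. -/
theorem exists_k4mFree_gt_bip_value :
    ∃ (D : SimpleGraph (Fin 5)) (_ : DecidableRel D.Adj),
      K4mFree D ∧ D.edgeFinset.card = 6 ∧ 6 * (5 - 2) / 2 < cherries D :=
  ⟨bowtie, inferInstance, k4mFree_bowtie, card_edges_bowtie, by rw [cherries_bowtie]; norm_num⟩

end C047

end TriangleCap

end PercRepro
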